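import Summits.FinalStateConjecture.FinalStateConjecture.Theorems.EIHFluxBalanceInertialRecessionStubEndgameOracleCross

/-!
# Route EIHFluxBalance — crux `InertialRecession`, line `sublinear-is-free-clean-window-charges`:
# the ABSTRACT endgame modulo a CAPPED increment oracle (`W ≤ 1`) — the cross-pair bootstrap (variant `W`)

Helper file for the crux `stmt-FinalStateConjecture-10166`
(`Summit.FinalStateConjecture.FinalStateConjecture.Theses.EIHFluxBalance.InertialRecession`), registered stub
`stub_pairwiseDichotomy` (lead reshape r7) of `Cruxes/InertialRecession/Lines/sublinear_is_free_clean_window_charges.lean`.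

This series (`…OracleCross`, `…OracleSlowGroup`, `…OracleTop`) ports the kernel-checked proof of the disprover's N-body toy
(`…Toy{Basics,Cross,Induction,Frozen}`: velocity-space clustering with a pigeonhole `Q`-gap, nested first-exit bootstraps) to the
crux's abstract "expanding system of charges" (centres in `E3`, relativistic charges `Mⱼγⱼ(1,vⱼ)`, slaving `ξ̇ − v → 0`), MODULO an
INCREMENT ORACLE: for every member set `S` whose internal relative speeds stay `≤ 30·W_min/Q` on `[t₁,t₂]` and all of whose
(member, outsider) pairs are BALLISTIC there (a fixed unit direction along which the relative coordinate has derivative `≥ W_min/2`),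
the energy and the momentum of `S` change by at most `Ω` — with `Ω` as small as desired after a late time depending on `Ω` and on
the floor `W_lo ≤ W_min`. The oracle is exactly what the window law + identification must supply (for `N ≤ 2` a single window does
it; in general it is the piece machinery of the lead's roadmap, `Endgame_generalN_roadmap.md` §4/§7); everything else of the
general-`N` argument is proved here once and for all.

THIS FILE (variant of `…OracleCross` in which the slow-group statement carries an upper bound `θ ≤ θmax`, so that the oracle is only ever
invoked with speed floors `W = Qθ/2 ≤ Qθmax/2`; the registered oracle of `stub_incrementOracle` is capped at `W ≤ 1`, which is all the
proof uses and all that the window machinery supplies): `oracleCrossBootstrapW` — the split phase: given the level-`d` slow-group statement `hΛ`, a group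
whose velocity configuration at `t₁` has an empty band (`< θ′` or `≥ Qθ′`, "`< θ′`" transitive, classes of size `≤ d`, `θ′` above
the level threshold) and whose outsiders are ballistic with floor `Qθ′/2`, keeps every member within `12θ′ + 12dθ_g` of its velocity
at `t₁` (nested bootstrap over the cross pairs with weak/strong tolerances `W/8`, `W/16`; the slaving error `e⋆ ≤ Qθ_g/16` keeps the
cross pairs ballistic at the derivative level with floor `Qθ′/2`).

References: D. Saari, Trans. AMS 156 (1971) 219–240; C. Marchal, D. Saari, J. Differential Equations 20 (1976) 150–186.
-/

noncomputable section

set_option linter.dupNamespace false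

open Filter Topology Set MeasureTheory
open scoped Topology BigOperators InnerProductSpace RealInnerProductSpace

namespace Summit.FinalStateConjecture.FinalStateConjecture.Theorems.SublinearIsFree.Oracle

open Literature.Geometry.Lorentzian
open Summit.FinalStateConjecture.FinalStateConjecture.Theorems.SublinearIsFree.Endgame
open Summit.FinalStateConjecture.FinalStateConjecture.Theorems.SublinearIsFree.Toy

/-! ### The cross-pair bootstrap modulo the oracle -/

set_option maxHeartbeats 800000 in
/-- **THE CROSS-PAIR BOOTSTRAP (split phase) for the abstract charges, modulo the increment oracle.** See the module
docstring. The hypotheses before `hΛ` are the abstract kinematics (continuous velocities, slaving error `≤ e⋆`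
after `T`), the threshold constants (`Q ≥ 400`, `θ_g > 0`, `16e⋆ ≤ Qθ_g`); `hΛ` is the level-`d` slow-group statement; then the
group data at `t₁` (empty band, transitivity, level threshold, class sizes) and the ballistic outsiders with floor `Qθ′/2`.
[folklore] -/
theorem oracleCrossBootstrapW {N : ℕ} {ξ v : Fin N → ℝ → E3} {T estar Q θg : ℝ}
    (hvc : ∀ i, Continuous (v i))
    (herr : ∀ i s, T ≤ s → ‖deriv (ξ i) s - v i s‖ ≤ estar)
    (hQ : 400 ≤ Q) (hθg : 0 < θg) (he : 16 * estar ≤ Q * θg)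
    {d : ℕ} {θmax : ℝ}
    (hΛ : ∀ (G : Finset (Fin N)), G.card ≤ d → G.Nonempty →
      ∀ (a₀ u θ : ℝ), T ≤ a₀ → a₀ ≤ u → 24 * (N + d) * θg * Q ^ (d ^ 3 + d) ≤ θ → θ ≤ θmax →
      (∀ k ∈ G, ∀ l ∈ G, ‖v k a₀ - v l a₀‖ ≤ θ) →
      (∀ i ∈ G, ∀ j ∉ G, ∃ n : E3, ‖n‖ = 1 ∧ ∀ s ∈ Icc a₀ u, Q * θ / 4 ≤ ⟪deriv (ξ j) s - deriv (ξ i) s, n⟫) →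
      ∀ t ∈ Icc a₀ u, ∀ k ∈ G, ‖v k t - v k a₀‖ ≤ 12 * θ + 12 * d * θg)
    {G : Finset (Fin N)} {t₁ u θ' : ℝ} (hTt₁ : T ≤ t₁) (ht₁u : t₁ ≤ u) (hθ'pos : 0 < θ')
    (hdich : ∀ k ∈ G, ∀ l ∈ G, ‖v k t₁ - v l t₁‖ < θ' ∨ Q * θ' ≤ ‖v k t₁ - v l t₁‖)
    (htrans : ∀ k ∈ G, ∀ l ∈ G, ∀ j ∈ G, ‖v k t₁ - v l t₁‖ < θ' → ‖v l t₁ - v j t₁‖ < θ' → ‖v k t₁ - v j t₁‖ < θ')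
    (hθ'ge : 24 * (N + d) * θg * Q ^ (d ^ 3 + d) ≤ θ') (hθ'max : θ' ≤ θmax)
    (hcls_card : ∀ k ∈ G, (G.filter fun l ↦ ‖v k t₁ - v l t₁‖ < θ').card ≤ d)
    (hout : ∀ i ∈ G, ∀ j ∉ G, ∃ n : E3, ‖n‖ = 1 ∧ ∀ s ∈ Icc t₁ u, Q * θ' / 4 ≤ ⟪deriv (ξ j) s - deriv (ξ i) s, n⟫) :
    ∀ k ∈ G, ∀ s ∈ Icc t₁ u, ‖v k s - v k t₁‖ ≤ 12 * θ' + 12 * d * θg := by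
  classical
  -- make the base `Q ^ _` harmless and derive the plain threshold
  have hQ1 : (1 : ℝ) ≤ Q := by linarith
  have hNθ' : 24 * (N + d) * θg ≤ θ' := by
    have h1 : (1 : ℝ) ≤ Q ^ (d ^ 3 + d) := one_le_pow₀ hQ1
    have h0 : 0 ≤ 24 * ((N : ℝ) + d) * θg := by positivity
    have := mul_le_mul_of_nonneg_left h1 h0
    linarith only [this, hθ'ge]
  -- classes
  set cls : Fin N → Finset (Fin N) := fun k ↦ G.filter fun l ↦ ‖v k t₁ - v l t₁‖ < θ' with hcls
  have hcls_sub : ∀ k, cls k ⊆ G := fun k ↦ Finset.filter_subset _ _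
  have hmem_cls : ∀ k ∈ G, k ∈ cls k := fun k hk ↦
    Finset.mem_filter.mpr ⟨hk, by simp [hθ'pos]⟩
  have hcls_slow : ∀ k ∈ G, ∀ k' ∈ cls k, ∀ l' ∈ cls k, ‖v k' t₁ - v l' t₁‖ < θ' := by
    intro k hk k' hk' l' hl'
    have h1 := (Finset.mem_filter.mp hk')
    have h2 := (Finset.mem_filter.mp hl')
    have h1' : ‖v k' t₁ - v k t₁‖ < θ' := by rw [norm_sub_rev]; exact h1.2
    exact htrans k' h1.1 k hk l' h2.1 h1' h2.2
  -- cross pairs (ordered), their speeds and directions at `t₁`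
  set I : Finset (Fin N × Fin N) := (G ×ˢ G).filter fun p ↦ θ' ≤ ‖v p.2 t₁ - v p.1 t₁‖ with hI
  have hI_fast : ∀ p ∈ I, Q * θ' ≤ ‖v p.2 t₁ - v p.1 t₁‖ := by
    intro p hp
    have h := Finset.mem_filter.mp hp
    have hG2 := Finset.mem_product.mp h.1
    rcases hdich p.2 hG2.2 p.1 hG2.1 with h' | h'
    · linarith [h.2]
    · exact h'
  have hI_pos : ∀ p ∈ I, 0 < ‖v p.2 t₁ - v p.1 t₁‖ := fun p hp ↦ by
    have := hI_fast p hp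
    have hQθ' : 0 < Q * θ' := by positivity
    linarith
  -- unit directions
  have hdir : ∀ p ∈ I, ∃ n : E3, ‖n‖ = 1 ∧ ⟪v p.2 t₁ - v p.1 t₁, n⟫ = ‖v p.2 t₁ - v p.1 t₁‖ := by
    intro p hp
    set W := ‖v p.2 t₁ - v p.1 t₁‖ with hW
    refine ⟨W⁻¹ • (v p.2 t₁ - v p.1 t₁), ?_, ?_⟩
    · rw [norm_smul, norm_inv, Real.norm_eq_abs, abs_of_pos (hI_pos p hp), inv_mul_cancel₀ (hI_pos p hp).ne']
    · have hW0 : W ≠ 0 := (hI_pos p hp).ne'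
      rw [real_inner_smul_right, real_inner_self_eq_norm_sq, ← hW, sq, ← mul_assoc, inv_mul_cancel₀ hW0, one_mul]
  choose! nd hnd hndW using hdir
  -- membership facts for cross pairs
  have hcross_mem : ∀ k ∈ G, ∀ i ∈ cls k, ∀ j ∈ G, j ∉ cls k → (i, j) ∈ I := by
    intro k hk i hi j hj hjn
    have hi' := Finset.mem_filter.mp hi
    refine Finset.mem_filter.mpr ⟨Finset.mem_product.mpr ⟨hi'.1, hj⟩, ?_⟩
    by_contra h
    push Not at h
    have h1 : ‖v i t₁ - v j t₁‖ < θ' := by rw [norm_sub_rev]; exact h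
    have h2 : ‖v k t₁ - v j t₁‖ < θ' := htrans k hk i hi'.1 j hj hi'.2 h1
    exact hjn (Finset.mem_filter.mpr ⟨hj, h2⟩)
  -- THE INNER DERIVATION: weak ballistic bounds for the cross pairs on `[t₁, u']` ⇒ class drifts via `hΛ`
  have inner : ∀ u' ∈ Icc t₁ u,
      (∀ p ∈ I, ∀ s ∈ Icc t₁ u', ‖(v p.2 s - v p.1 s) - (v p.2 t₁ - v p.1 t₁)‖ ≤ ‖v p.2 t₁ - v p.1 t₁‖ / 8) →
      ∀ k ∈ G, ∀ s ∈ Icc t₁ u', ‖v k s - v k t₁‖ ≤ 12 * θ' + 12 * d * θg := by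
    intro u' hu' hweak k hk s hs
    -- ballistic outsiders of the class of `k`, at the derivative level, with floor `Qθ'/2`
    have hout' : ∀ i ∈ cls k, ∀ j ∉ cls k, ∃ n : E3, ‖n‖ = 1 ∧
        ∀ s ∈ Icc t₁ u', Q * θ' / 4 ≤ ⟪deriv (ξ j) s - deriv (ξ i) s, n⟫ := by
      intro i hi j hj
      by_cases hjG : j ∈ G
      · -- a cross pair inside `G`
        have hp : (i, j) ∈ I := hcross_mem k hk i hi j hjG hj
        refine ⟨nd (i, j), hnd (i, j) hp, fun s' hs' ↦ ?_⟩
        set W := ‖v j t₁ - v i t₁‖ with hW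
        have hWQ : Q * θ' ≤ W := hI_fast (i, j) hp
        -- velocity level: `⟪v_j − v_i, n⟫ ≥ W − W/8`
        have hvel : 7 * W / 8 ≤ ⟪v j s' - v i s', nd (i, j)⟫ := by
          have hdev := hweak (i, j) hp s' hs'
          have h0 : ⟪v j t₁ - v i t₁, nd (i, j)⟫ = W := hndW (i, j) hp
          have hsplit : ⟪v j s' - v i s', nd (i, j)⟫ =
              ⟪v j t₁ - v i t₁, nd (i, j)⟫ + ⟪(v j s' - v i s') - (v j t₁ - v i t₁), nd (i, j)⟫ := by
            rw [← inner_add_left]; congr 1; abel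
          have h1 : |⟪(v j s' - v i s') - (v j t₁ - v i t₁), nd (i, j)⟫| ≤ W / 8 := by
            calc |⟪(v j s' - v i s') - (v j t₁ - v i t₁), nd (i, j)⟫|
                ≤ ‖(v j s' - v i s') - (v j t₁ - v i t₁)‖ * ‖nd (i, j)‖ := abs_real_inner_le_norm _ _
              _ ≤ W / 8 := by rw [hnd (i, j) hp, mul_one]; exact hdev
          rw [hsplit, h0]
          linarith [neg_abs_le ⟪(v j s' - v i s') - (v j t₁ - v i t₁), nd (i, j)⟫]
        -- derivative level via the slaving errors `≤ e⋆ ≤ W/16`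
        have hT' : T ≤ s' := hTt₁.trans hs'.1
        have hθgθ' : θg ≤ θ' := by
          have hN1 : (1 : ℝ) ≤ N := by
            have : 0 < N := Fin.pos i
            exact_mod_cast this
          have hd0 : (0 : ℝ) ≤ d := by positivity
          nlinarith [hNθ', hN1, hd0, hθg]
        have heW : estar ≤ W / 16 := by
          have : Q * θg ≤ W := (mul_le_mul_of_nonneg_left hθgθ' (by linarith)).trans hWQ
          linarith
        have h34 := inner_deriv_ge_of_inner_velocity_ge (hnd (i, j) hp) hvel (herr i s' hT') (herr j s' hT') heW
        have hQθ' : 0 ≤ Q * θ' := by positivity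
        linarith
      · -- an outsider of `G`
        obtain ⟨n, hn, hball⟩ := hout i (hcls_sub k hi) j hjG
        exact ⟨n, hn, fun s' hs' ↦ hball s' ⟨hs'.1, hs'.2.trans hu'.2⟩⟩
    exact hΛ (cls k) (hcls_card k hk) ⟨k, hmem_cls k hk⟩ t₁ u' θ' hTt₁ hu'.1 hθ'ge hθ'max
      (fun k' hk' l' hl' ↦ (hcls_slow k hk k' hk' l' hl').le) hout' s hs k (hmem_cls k hk)
  -- THE NESTED BOOTSTRAP on `[t₁, u]` (weak tolerance `W/8`, strong `W/16`)
  have hboot : ∀ p ∈ I, ∀ s ∈ Icc t₁ u,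
      ‖(v p.2 s - v p.1 s) - (v p.2 t₁ - v p.1 t₁)‖ ≤ ‖v p.2 t₁ - v p.1 t₁‖ / 16 := by
    refine bootstrap_principle I (fun p s ↦ ‖(v p.2 s - v p.1 s) - (v p.2 t₁ - v p.1 t₁)‖)
      (fun p ↦ ‖v p.2 t₁ - v p.1 t₁‖ / 8) (fun p ↦ ‖v p.2 t₁ - v p.1 t₁‖ / 16) ht₁u
      (fun p _ ↦ (((hvc p.2).sub (hvc p.1)).sub continuous_const).norm)
      (fun p hp ↦ by linarith [hI_pos p hp]) (fun p hp ↦ by simp; positivity) ?_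
    intro u' hu' hweak p hp s hs
    have hG2 := Finset.mem_product.mp (Finset.mem_filter.mp hp).1
    have h1 := inner u' hu' hweak p.1 hG2.1 s hs
    have h2 := inner u' hu' hweak p.2 hG2.2 s hs
    have hdθ : 12 * (d : ℝ) * θg ≤ θ' / 2 := by
      have hN0 : (0 : ℝ) ≤ N := by positivity
      nlinarith
    calc ‖(v p.2 s - v p.1 s) - (v p.2 t₁ - v p.1 t₁)‖ = ‖(v p.2 s - v p.2 t₁) - (v p.1 s - v p.1 t₁)‖ := by abel_nf
      _ ≤ ‖v p.2 s - v p.2 t₁‖ + ‖v p.1 s - v p.1 t₁‖ := norm_sub_le _ _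
      _ ≤ 2 * (12 * θ' + 12 * d * θg) := by linarith
      _ ≤ 25 * θ' := by linarith
      _ ≤ ‖v p.2 t₁ - v p.1 t₁‖ / 16 := by
          have h400 : 400 * θ' ≤ Q * θ' := mul_le_mul_of_nonneg_right hQ hθ'pos.le
          linarith [hI_fast p hp]
  -- consequently the class drifts hold on all of `[t₁, u]`
  intro k hk s hs
  exact inner u ⟨ht₁u, le_rfl⟩ (fun p hp s hs ↦ (hboot p hp s hs).trans (by linarith [hI_pos p hp])) k hk s hs

/-- Registered helper form: capping the speed floor (carrier of this file). [folklore] -/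
theorem oracleW_theta_cap : ∀ (Q θ θmax : ℝ), 0 ≤ Q → θ ≤ θmax → Q * θ / 2 ≤ Q * θmax / 2 := by
  intro Q θ θmax hQ h
  have := mul_le_mul_of_nonneg_left h hQ
  linarith

end Summit.FinalStateConjecture.FinalStateConjecture.Theorems.SublinearIsFree.Oracle

end
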